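import Summits.ResolutionOfSingularities.ResolutionOfSingularities.Theorems.RadicialJungCleanModelsKbarRationalOfCossart1987
import HarnessLib

/-!
# Route `RadicialJung`, crux `CleanModels` (stmt-15917): the PERFECT-field dim-3 slice, CONDITIONAL on the research hypothesis
# «Cossart/Posva's `ν = 0` normal form for a rational function holds over every PERFECT ground field» — a kernel certificate that
# nothing else is missing there

Explicit-unit seat `decomp-res-hand-1` g22.  OURS, def-free, counted 0.  Nothing here proves resolution in characteristic `p`.  The hypothesis
`hCRp` is NOT a printed theorem: it is `Literature.AlgebraicGeometry.Resolution.Cossart1987ThmRational` (Posva 2024 Claim 5.1.2 / App. A §A.7, over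
`k = k̄`) with `IsAlgClosed k` weakened to `PerfectField k`, spelled out — the EXACT research target recorded in `Cruxes/CleanModels/Lines/Sketch-memo-hand1-g22.md` §4
(plausible route: Cossart's algorithm is canonical in `(X, 𝒥, E)`, hence Gal(k̄/k)-equivariant; regularity and `NuZeroAt` descend along the unramified
faithfully flat `𝒪_{V₀,x₀} → 𝒪_{V,x}`).  GIVEN it, the dim-3 slice of the crux over every perfect field follows exactly as over `k̄`
(✓ `KbarRational.cleanModelsAt_dimThree_algClosed_of_cossartRational_of_cp2008`): Chow ✓, Cossart–Piltant 2008 Thm. 2.1 (✓-typed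
`CP2008.ResolutionQuasiProjectiveThreefolds`, valid over every field differentially finite over a perfect field, in particular every perfect field), the
packaging ✓ `KbarRational.cleanModelsAt_of_nuZeroAt_closedPoints` (every field).  So on {`k` perfect, `dim W ≤ 3`} the registered line's research stubs 5
(class (B)) and 6 (X44c) would be superseded by this ONE statement; they remain necessary as filed for IMPERFECT `k`.

* `cleanModelsAt_dimThree_perfect_of_cossartRationalPerfect_of_cp2008` — the conditional dim-3 perfect-field slice.
* `cleanModelsAt_dimLEThree_perfect_of_cossartRationalPerfect_of_cp2008` — with `dim ≤ 2` unconditional (✓ F-75c).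
-/

noncomputable section

set_option linter.dupNamespace false -- mandated namespace of this single-conjunct summit

open IsLocalRing
open Literature.AlgebraicGeometry.Resolution
open Summit.ResolutionOfSingularities.ResolutionOfSingularities.Theorems.RadicialJung.CleanModels
open CategoryTheory AlgebraicGeometry TopologicalSpace
open Literature.AlgebraicGeometry.CossartPiltant200819.CP2008
open Literature.AlgebraicGeometry.Motives

namespace Summit.ResolutionOfSingularities.ResolutionOfSingularities.Theorems.RadicialJung.CleanModels.KbarRational

/-- **CONDITIONAL: `CleanModels` in dimension `3` over every PERFECT field, from «Cossart/Posva over perfect ground fields» (research hypothesis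
`hCRp`, NOT in print — `Cossart1987ThmRational` with `IsAlgClosed k ↦ PerfectField k`) and Cossart–Piltant 2008 Thm. 2.1.**  Proof verbatim as
`cleanModelsAt_dimThree_algClosed_of_cossartRational_of_cp2008` (a perfect field is differentially finite over itself; regularity of `W` not needed).
[cite: Posva2024, Claim 5.1.2 and App. A §A.7] [cite: CossartPiltant2008, Thm 2.1 (HAL p. 3)] [cite: GortzWedhorn2020, Thm 13.100] -/
theorem cleanModelsAt_dimThree_perfect_of_cossartRationalPerfect_of_cp2008
    (hCRp : ∀ (p : ℕ) [Fact p.Prime] (k : Type) [Field k] [CharP k p] [PerfectField k]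
      (X : Scheme.{0}) [IsIntegral X] [CompactSpace X] (sX : X ⟶ Spec (.of k))
      [LocallyOfFiniteType sX] [IsSeparated sX],
      IsQuasiProjectiveOver sX → Scheme.IsRegular X → topologicalKrullDim X = 3 →
      ∀ u : X.functionField, (∀ c : X.functionField, c ^ p ≠ u) →
      ∃ (X' : Scheme.{0}) (π : X' ⟶ X) (_ : IsIntegral X') (_ : IsDominant π),
        IsProper π ∧ Scheme.IsRegular X' ∧ (∃ U : X.Opens, (U : Set X).Nonempty ∧ IsIso (π ∣_ U)) ∧
        ∀ x' : X', ∃ (v : X.functionField) (g : X'.presheaf.stalk x'), v ≠ 0 ∧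
          algebraMap (X'.presheaf.stalk x') X'.functionField g = RatFn.functionFieldMap π (u * v ^ p) ∧
          NuZeroAt g)
    (h21 : ResolutionQuasiProjectiveThreefolds.{0})
    (p : ℕ) (hp : p.Prime) (k : Type) [Field k] [CharP k p] [PerfectField k]
    (W : Scheme.{0}) [IsIntegral W] (f : W ⟶ Spec (.of k)) [IsSeparated f] [LocallyOfFiniteType f]
    [QuasiCompact f] (hdim : topologicalKrullDim W = 3)
    (L : Type) [Field L] [Algebra W.functionField L]
    [IsPurelyInseparable W.functionField L] (hdeg : Module.finrank W.functionField L = p) :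
    ∃ (V : Scheme.{0}) (π : V ⟶ W) (_ : IsIntegral V) (_ : IsDominant π),
      IsProper π ∧ IsBirational π ∧ Scheme.IsRegular V ∧
      (∀ v : V, (∃ (y : L) (g : W.functionField), y ∉ Set.range (algebraMap W.functionField L) ∧
        algebraMap W.functionField L g = y ^ p ∧
        ((∃ (d m : ℕ) (hmd : m ≤ d) (t : Fin d → V.presheaf.stalk v) (a : Fin m → ℕ),
            Ideal.span (Set.range t) = maximalIdeal (V.presheaf.stalk v) ∧
            ringKrullDim (V.presheaf.stalk v) = (d : WithBot ℕ∞) ∧ 0 < m ∧ (∀ i, ¬ p ∣ a i) ∧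
            RatFn.functionFieldMap π g = ∏ i : Fin m,
              (algebraMap (V.presheaf.stalk v) V.functionField (t (Fin.castLE hmd i))) ^ (a i)) ∨
          (∃ u₀ : V.presheaf.stalk v, IsUnit u₀ ∧
            RatFn.functionFieldMap π g = algebraMap (V.presheaf.stalk v) V.functionField u₀ ∧
            ((∀ c : V.presheaf.stalk v, u₀ - c ^ p ∉ maximalIdeal (V.presheaf.stalk v)) ∨
              (∃ c : V.presheaf.stalk v, u₀ - c ^ p ∈ maximalIdeal (V.presheaf.stalk v) ∧
                u₀ - c ^ p ∉ maximalIdeal (V.presheaf.stalk v) ^ 2)))))) := by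
  classical
  haveI : Fact p.Prime := ⟨hp⟩
  haveI : CharP W.functionField p := charP_stalk W f _
  obtain ⟨-, y₀, g₀, hy₀, hg₀, hg₀p⟩ := stub_generator (K := W.functionField) (L := L) p hp hdeg
  /- (1) Chow: `W ← X₁ ↪ ℙⁿ` -/
  obtain ⟨n, X₁, π₁, ι, hX₁int, hι, hπ₁prop, -, hcomm, U₀, hU₀, hU₀', hiso₀⟩ :=
    ChowLemmaIntegral_holds k W f inferInstance inferInstance inferInstance inferInstance
  haveI := hX₁int
  haveI := hπ₁prop
  haveI := hiso₀
  have hbir₁ : IsBirational π₁ := ⟨U₀, hU₀, hU₀', hiso₀⟩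
  haveI : IsDominant π₁ := hbir₁.isDominant
  let f₁ : X₁ ⟶ Spec (.of k) := π₁ ≫ f
  have hqp₁ : IsQuasiProjectiveOver f₁ := ⟨n, ι, hι, hcomm⟩
  haveI : LocallyOfFiniteType f₁ := inferInstance
  have hdim₁ : topologicalKrullDim X₁ = 3 := by
    -- birational invariance of dimension through the common open `π₁⁻¹(U₀) ≅ U₀`
    have hne : ((π₁ ⁻¹ᵁ U₀ : X₁.Opens) : Set X₁).Nonempty := hU₀'.nonempty
    haveI : Nonempty (π₁ ⁻¹ᵁ U₀ : X₁.Opens) := hne.to_subtype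
    rw [← hdim, ← topologicalKrullDim_opens_eq f₁ (π₁ ⁻¹ᵁ U₀) hne]
    exact topologicalKrullDim_eq_of_isOpenImmersion f ((π₁ ∣_ U₀) ≫ U₀.ι)
  /- (2) Cossart–Piltant 2008 Thm. 2.1: `X₁ ← X₂` projective, `X₂` regular, an isomorphism over `Reg X₁` -/
  obtain ⟨X₂, π₂, hproj, hX₂reg, ⟨U₁, hU₁, hiso₁⟩, hsnc⟩ :=
    h21 p k (Summit.ResolutionOfSingularities.ResolutionOfSingularities.Cruxes.EquisingularLift.StrataSplit.isDifferentiallyFinite_of_perfectField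
      k) X₁ f₁ hqp₁ hdim₁
  haveI := hiso₁
  haveI : IsProper π₂ := hproj.isProper
  have hd₂ : Dense ((π₂ ⁻¹ᵁ U₁ : X₂.Opens) : Set X₂) := by
    have := hsnc.dense_compl
    rw [Set.preimage_compl, compl_compl, ← hU₁] at this
    exact this
  have hbir₂ : IsBirational π₂ := isBirational_of_isIso_restrict π₂ U₁ hU₁.ge hd₂
  haveI : IsReduced X₂ := hX₂reg.isReduced
  haveI : IsIntegral X₂ := hbir₂.isIntegral
  haveI : IsDominant π₂ := hbir₂.isDominant
  let f₂ : X₂ ⟶ Spec (.of k) := π₂ ≫ f₁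
  have hqp₂ : IsQuasiProjectiveOver f₂ := hqp₁.comp_isProjectiveOver hproj
  obtain ⟨hlft₂, hsep₂, hqc₂⟩ := hqp₂.finiteType_isSeparated_quasiCompact
  haveI := hlft₂; haveI := hsep₂; haveI := hqc₂
  haveI : CompactSpace X₂ := QuasiCompact.compactSpace_of_compactSpace f₂
  haveI : LocallyOfFiniteType π₂ := inferInstance
  have hdim₂ : topologicalKrullDim X₂ = 3 := by
    have hne : ((π₂ ⁻¹ᵁ U₁ : X₂.Opens) : Set X₂).Nonempty := hd₂.nonempty
    haveI : Nonempty (π₂ ⁻¹ᵁ U₁ : X₂.Opens) := hne.to_subtype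
    rw [← hdim₁, ← topologicalKrullDim_opens_eq f₂ (π₂ ⁻¹ᵁ U₁) hne]
    exact topologicalKrullDim_eq_of_isOpenImmersion f₁ ((π₂ ∣_ U₁) ≫ U₁.ι)
  /- the radicand upstairs -/
  let π₂₁ : X₂ ⟶ W := π₂ ≫ π₁
  have hbir₂₁ : IsBirational π₂₁ := hbir₂.comp hbir₁
  haveI : IsDominant π₂₁ := hbir₂₁.isDominant
  have hbij₂₁ : Function.Bijective (RatFn.functionFieldMap π₂₁) := by
    obtain ⟨U', hU', hU'', hiso⟩ := hbir₂₁
    haveI := hiso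
    exact RatFn.functionFieldMap_bijective_of_isIso_morphismRestrict π₂₁ U' hU' hU''
  let u₂ : X₂.functionField := RatFn.functionFieldMap π₂₁ g₀
  have hu₂ : ∀ c : X₂.functionField, c ^ p ≠ u₂ := by
    intro c hc
    obtain ⟨c', rfl⟩ := hbij₂₁.2 c
    exact hg₀p c' (hbij₂₁.1 (by rw [map_pow]; exact hc))
  /- (3) Cossart/Posva on `X₂` -/
  obtain ⟨V, π₃, hVint, hdom₃, hπ₃, hVreg, ⟨U₂, hU₂ne, hiso₂⟩, hν⟩ := hCRp p k X₂ f₂ hqp₂ hX₂reg hdim₂ u₂ hu₂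
  haveI := hVint
  haveI := hdom₃
  haveI := hπ₃
  haveI := hiso₂
  obtain ⟨hbir₃, -⟩ := Lens5.KbarCossart.isBirational_and_denseRange π₃ U₂ hU₂ne
  /- (4) the composite `V → W` and the transported representatives -/
  let π : V ⟶ W := π₃ ≫ π₂₁
  have hbir : IsBirational π := hbir₃.comp hbir₂₁
  haveI hdom : IsDominant π := hbir.isDominant
  haveI : IsProper π := inferInstance
  have hcomp : ∀ z : W.functionField,
      RatFn.functionFieldMap π z = RatFn.functionFieldMap π₃ (RatFn.functionFieldMap π₂₁ z) := fun z =>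
    RingHom.congr_fun (RatFn.functionFieldMap_comp π₂₁ π₃) z
  have hν' : ∀ x : V, IsClosed ({x} : Set V) → ∃ (v : W.functionField) (g : V.presheaf.stalk x), v ≠ 0 ∧
      algebraMap (V.presheaf.stalk x) V.functionField g = RatFn.functionFieldMap π (g₀ * v ^ p) ∧ NuZeroAt g := by
    intro x _
    obtain ⟨v₂, g, hv₂, hg, hN⟩ := hν x
    obtain ⟨v, rfl⟩ := hbij₂₁.2 v₂
    refine ⟨v, g, fun h0 => hv₂ (by rw [h0, map_zero]), ?_, hN⟩
    rw [hg, hcomp]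
    simp only [map_mul, map_pow, u₂]
  exact ⟨V, π, hVint, hdom, inferInstance, hbir, hVreg, fun x =>
    cleanModelsAt_of_nuZeroAt_closedPoints p hp k W f L y₀ g₀ hy₀ hg₀ V π hbir hVreg hν' x⟩

/-- **CONDITIONAL: the perfect-field slice in `dim ≤ 3`** (dimension `≤ 2` unconditional ✓ F-75c; dimension `3` the previous theorem).
[cite: Posva2024, Claim 5.1.2 and App. A §A.7] [cite: CossartPiltant2008, Thm 2.1 (HAL p. 3)] [cite: StacksProject, Tag 0BIC] -/
theorem cleanModelsAt_dimLEThree_perfect_of_cossartRationalPerfect_of_cp2008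
    (hCRp : ∀ (p : ℕ) [Fact p.Prime] (k : Type) [Field k] [CharP k p] [PerfectField k]
      (X : Scheme.{0}) [IsIntegral X] [CompactSpace X] (sX : X ⟶ Spec (.of k))
      [LocallyOfFiniteType sX] [IsSeparated sX],
      IsQuasiProjectiveOver sX → Scheme.IsRegular X → topologicalKrullDim X = 3 →
      ∀ u : X.functionField, (∀ c : X.functionField, c ^ p ≠ u) →
      ∃ (X' : Scheme.{0}) (π : X' ⟶ X) (_ : IsIntegral X') (_ : IsDominant π),
        IsProper π ∧ Scheme.IsRegular X' ∧ (∃ U : X.Opens, (U : Set X).Nonempty ∧ IsIso (π ∣_ U)) ∧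
        ∀ x' : X', ∃ (v : X.functionField) (g : X'.presheaf.stalk x'), v ≠ 0 ∧
          algebraMap (X'.presheaf.stalk x') X'.functionField g = RatFn.functionFieldMap π (u * v ^ p) ∧
          NuZeroAt g)
    (h21 : ResolutionQuasiProjectiveThreefolds.{0})
    (p : ℕ) (hp : p.Prime) (k : Type) [Field k] [CharP k p] [PerfectField k]
    (W : Scheme.{0}) [IsIntegral W] (f : W ⟶ Spec (.of k)) [IsSeparated f] [LocallyOfFiniteType f]
    [QuasiCompact f] (hW : Scheme.IsRegular W) (hdim : topologicalKrullDim W ≤ 3)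
    (L : Type) [Field L] [Algebra W.functionField L]
    [IsPurelyInseparable W.functionField L] (hdeg : Module.finrank W.functionField L = p) :
    ∃ (V : Scheme.{0}) (π : V ⟶ W) (_ : IsIntegral V) (_ : IsDominant π),
      IsProper π ∧ IsBirational π ∧ Scheme.IsRegular V ∧
      (∀ v : V, (∃ (y : L) (g : W.functionField), y ∉ Set.range (algebraMap W.functionField L) ∧
        algebraMap W.functionField L g = y ^ p ∧
        ((∃ (d m : ℕ) (hmd : m ≤ d) (t : Fin d → V.presheaf.stalk v) (a : Fin m → ℕ),
            Ideal.span (Set.range t) = maximalIdeal (V.presheaf.stalk v) ∧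
            ringKrullDim (V.presheaf.stalk v) = (d : WithBot ℕ∞) ∧ 0 < m ∧ (∀ i, ¬ p ∣ a i) ∧
            RatFn.functionFieldMap π g = ∏ i : Fin m,
              (algebraMap (V.presheaf.stalk v) V.functionField (t (Fin.castLE hmd i))) ^ (a i)) ∨
          (∃ u₀ : V.presheaf.stalk v, IsUnit u₀ ∧
            RatFn.functionFieldMap π g = algebraMap (V.presheaf.stalk v) V.functionField u₀ ∧
            ((∀ c : V.presheaf.stalk v, u₀ - c ^ p ∉ maximalIdeal (V.presheaf.stalk v)) ∨
              (∃ c : V.presheaf.stalk v, u₀ - c ^ p ∈ maximalIdeal (V.presheaf.stalk v) ∧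
                u₀ - c ^ p ∉ maximalIdeal (V.presheaf.stalk v) ^ 2)))))) := by
  rcases le_two_or_eq_three_of_le_three hdim with h2 | h3
  · exact cleanModels_dimLETwo_of_f75c stub_stacks0BICLocus p hp k W f hW L hdeg h2
  · exact cleanModelsAt_dimThree_perfect_of_cossartRationalPerfect_of_cp2008 hCRp h21 p hp k W f h3 L hdeg

end Summit.ResolutionOfSingularities.ResolutionOfSingularities.Theorems.RadicialJung.CleanModels.KbarRational

end
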